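import Mathlib
import Literature.Combinatorics.Additive.TripleProductProperty
import Summits.MatrixMultiplication.MatrixMultiplication.Theorems.SnSubsetDichotomyThresholdSubsetTriplesPairFactorisation

/-!
# `SnSubsetDichotomy.ThresholdSubsetTriples`, line `interleaved-subsignature-ascent` — stub `stub_ownerPairNoThird`

Registered stub `stub_ownerPairNoThird` of crux `stmt-MatrixMultiplication-10882` (negative design rule of
census c3a): an EXACT chain pair — the owner classes `S_A = subsig (ownerSystem L)` and
`S_B = subsig (ownerSystem Lᶜ)` of a level set `L`, which factorise `S_n` exactly
(`stub_pairFactorisation`) — admits no third class with two elements: if `(S_A, S_B, U)` has the triple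
product property (Cohn–Umans 2003, Def. 2.1, tree `Literature.Combinatorics.Additive.TripleProductProperty`)
then `|U| ≤ 1`.

Proof (elementary).  Every level `k` of an owner system carries its identity letter (`k ∈ ownerSystem L k`,
i.e. `swap k k = 1` is a letter of the star piece of level `k`), so the identity permutation is a word of
both classes (`one_mem_subsig_ownerSystem`).  Given `u, u' ∈ U`, factor `(u u'⁻¹)⁻¹ = a⁻¹ b` with `a ∈ S_A`,
`b ∈ S_B` (existence half of `stub_pairFactorisation`); then `1 · a⁻¹ · (b · 1⁻¹) · (u u'⁻¹) = 1` is a TPP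
relation, whence `u = u'`.  So all elements of `U` coincide (`Finset.card_le_one`).
-/

-- `Summit.<Summit>.<Problem>` is the tree's mandated summit-side namespace; for this single-conjunct summit the
-- two components coincide, so the file silences `dupNamespace` (same as the vocabulary files it imports).
set_option linter.dupNamespace false
set_option autoImplicit false

namespace Summit.MatrixMultiplication.MatrixMultiplication.Theorems.ThresholdSubsetTriples

open scoped Pointwise
open Literature.Combinatorics.Additive

namespace OwnerPairNoThirdK14

variable {n : ℕ}

/-- If every level of a direction system carries its identity letter (`k ∈ D k`, encoding `swap k k = 1`),
then the identity permutation is a word of every lower chain class `subsigBelow D m`. -/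
theorem one_mem_subsigBelow (D : Fin n → Finset (Fin n)) (hD : ∀ k, k ∈ D k) :
    ∀ m : ℕ, (1 : Equiv.Perm (Fin n)) ∈ subsigBelow D m := by
  intro m
  induction m with
  | zero =>
    rw [subsigBelow_zero]
    exact Finset.mem_singleton_self 1
  | succ m ih =>
    rw [subsigBelow_succ]
    have h1 : (1 : Equiv.Perm (Fin n)) ∈
        (if h : m < n then starPiece (D ⟨m, h⟩) ⟨m, h⟩ else {1}) := by
      split_ifs with h
      · exact mem_starPiece.2 ⟨⟨m, h⟩, hD _, Equiv.swap_self _⟩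
      · exact Finset.mem_singleton_self 1
    simpa only [mul_one] using Finset.mul_mem_mul h1 ih

/-- Every level `k` of an owner system carries its identity letter `k`. -/
theorem self_mem_ownerSystem (L : Finset (Fin n)) (k : Fin n) : k ∈ ownerSystem L k := by
  by_cases hk : k ∈ L
  · rw [ownerSystem_of_mem hk, Finset.mem_filter]
    exact ⟨Finset.mem_univ _, le_rfl⟩
  · rw [ownerSystem_of_not_mem hk]
    exact Finset.mem_singleton_self k

/-- The identity permutation is a word of every owner chain class `subsig (ownerSystem L)`. -/
theorem one_mem_subsig_ownerSystem (L : Finset (Fin n)) :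
    (1 : Equiv.Perm (Fin n)) ∈ subsig (ownerSystem L) :=
  one_mem_subsigBelow _ (self_mem_ownerSystem L) n

end OwnerPairNoThirdK14

open OwnerPairNoThirdK14 in
/-- **Stub `stub_ownerPairNoThird` — an exact chain pair admits no third class** (crux
`stmt-MatrixMultiplication-10882`, census c3a design rule).  For every level set `L`, if the owner chain
classes `subsig (ownerSystem L)`, `subsig (ownerSystem Lᶜ)` and a set `U` of permutations have the triple
product property, then `|U| ≤ 1`: since `1` lies in both classes and every permutation is `a⁻¹ b` with
`a ∈ subsig (ownerSystem L)`, `b ∈ subsig (ownerSystem Lᶜ)` (`stub_pairFactorisation`), the quotient set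
`Q(S_A) Q(S_B) ⊇ S_A⁻¹ S_B` is all of `S_n`, so `u u'⁻¹ = 1` for all `u, u' ∈ U`. -/
theorem stub_ownerPairNoThird {n : ℕ} (L : Finset (Fin n)) (U : Finset (Equiv.Perm (Fin n)))
    (hT : TripleProductProperty (subsig (ownerSystem L)) (subsig (ownerSystem Lᶜ)) U) : U.card ≤ 1 := by
  rw [Finset.card_le_one]
  intro u hu u' hu'
  obtain ⟨p, ha, hb, hab⟩ := (stub_pairFactorisation L (u * u'⁻¹)⁻¹).exists
  have h1A : (1 : Equiv.Perm (Fin n)) ∈ subsig (ownerSystem L) := one_mem_subsig_ownerSystem L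
  have h1B : (1 : Equiv.Perm (Fin n)) ∈ subsig (ownerSystem Lᶜ) := one_mem_subsig_ownerSystem Lᶜ
  have hrel : (1 : Equiv.Perm (Fin n)) * p.1⁻¹ * (p.2 * 1⁻¹) * (u * u'⁻¹) = 1 := by
    rw [one_mul, inv_one, mul_one, hab, inv_mul_cancel]
  exact (hT 1 h1A p.1 ha p.2 hb 1 h1B u hu u' hu' hrel).2.2

end Summit.MatrixMultiplication.MatrixMultiplication.Theorems.ThresholdSubsetTriples
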